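import Summits.Ventures.LatticeQCDFlow.Scoring.SU2TorusStripMerging
import HarnessLib

/-!
# SU(2) on the 2-torus: merging the plaquettes of a lattice RECTANGLE into the character of its boundary holonomy, inside the full product Haar integral

HONEST FRAMING: exact (Metropolis-corrected) sampling algorithms for lattice gauge theory;
figures of merit are autocorrelation/cost numbers at stated couplings and volumes; no
continuum-physics claim.

Venture `LatticeQCDFlow` (cell pub-lqcd), sub-topic `Scoring`; FANOUT row 5 (`s0-sun-a`), GEN-11.
NEW WORK of the cell (placement rule); the local tool behind the exact SU(2) torus WILSON LOOPS and
POLYAKOV-LOOP correlators.  Notation as in `SU2TorusStripMerging`: `h(x) = V(x,0)`, `v(x) = V(x,1)`,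
`U_x` the plaquette at `x`, `χ_n = U_n(a₀)`.  For a corner `(i,j)` and sizes `1 ≤ R ≤ L`, `1 ≤ T ≤ L`,

  `W_{R×T}(V) = [h(i,j)⋯h(i+R−1,j)] · [v(i+R,j)⋯v(i+R,j+T−1)] · [h(i,j+T)⋯h(i+R−1,j+T)]⁻¹ · [v(i,j)⋯v(i,j+T−1)]⁻¹`

is the holonomy around the boundary of the lattice rectangle `[i,i+R) × [j,j+T)`: for `R, T ≤ L − 1` a
contractible `R × T` WILSON LOOP; for `R = L` the word `P_j · S · P_{j+T}⁻¹ · S⁻¹` of the annulus between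
the Polyakov lines `P_j`, `P_{j+T}` cut open along the vertical line `S = v(i,j)⋯v(i,j+T−1)`; for
`R = T = L` the one-face presentation `P S P⁻¹ S⁻¹` of the torus.

* **`integral_mul_prod_rect_su2Character`** — THE MERGING LEMMA: for every continuous spectator
  `F : (E → SU(2)) → ℝ` not depending on the INTERIOR links of the rectangle (`v(i+a,j+b)`, `0 < a < R`,
  `b < T`, and `h(i,j+b)`, `0 < b < T`) and every assignment `m : Λ → ℕ` of representations,
  `∫ F · ∏_{b<T} ∏_{a<R} χ_{m(i+a,j+b)}(U_{(i+a,j+b)}) dHaar^{⊗E}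
     = [m ≡ m(i,j) on the rectangle] · ((m(i,j)+1)^{RT−1})⁻¹ · ∫ F · χ_{m(i,j)}(W_{R×T}) dHaar^{⊗E}`.
  Induction on `T`: the rows are merged into strips by `integral_mul_prod_strip_su2Character`, and the
  FIRST link `h(i,j+b)` of each interior rung merges consecutive strips
  (`SU2CharacterRowIntegral.integral_pi_su2_merge`; the remaining rung links cancel inside the merged
  word) — `RT − 1` one-link integrations in all, each costing a factor `(m(i,j)+1)⁻¹`.

Run backwards against the typed full-torus integral `∫ ∏_x χ_{m_x}(U_x) = [m const]·(m_0+1)^{−L²}`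
(`SU2TorusCharacterIntegral`) this evaluates every loop insertion (next files).  Elementary; nothing is
cited; no `def`.
-/

noncomputable section

open Real MeasureTheory Set Function Finset Polynomial.Chebyshev
open Literature.MathematicalPhysics.QuantumFieldTheory Literature.MathematicalPhysics.QuantumLattice
open Summit.Ventures.LatticeQCDFlow.Exactness
open Summit.Ventures.LatticeQCDFlow.Theory2.Lattice

namespace Summit.Ventures.LatticeQCDFlow.Scoring

variable {L : ℕ} [NeZero L]

/-- **MERGING THE PLAQUETTES OF A RECTANGLE** (`1 ≤ R ≤ L`, `1 ≤ T ≤ L`, corner `(i,j)`).  For every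
continuous spectator `F` not depending on the interior links `v(i+a,j+b)` (`0 < a < R`, `b < T`) and
`h(i,j+b)` (`0 < b < T`) of the rectangle `[i,i+R) × [j,j+T)`, and every `m : Λ → ℕ`:
`∫ F · ∏_{b<T} ∏_{a<R} χ_{m(i+a,j+b)}(U_{(i+a,j+b)}) dHaar^{⊗E}
   = [∀ a<R, ∀ b<T, m(i+a,j+b) = m(i,j)] · ((m(i,j)+1)^{RT−1})⁻¹ · ∫ F · χ_{m(i,j)}(W_{R×T}) dHaar^{⊗E}`,
`W_{R×T} = [h(i,j)⋯h(i+R−1,j)]·[v(i+R,j)⋯v(i+R,j+T−1)]·[h(i,j+T)⋯h(i+R−1,j+T)]⁻¹·[v(i,j)⋯v(i,j+T−1)]⁻¹`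
the boundary holonomy (a contractible `R × T` Wilson loop when `R, T ≤ L − 1`). -/
theorem integral_mul_prod_rect_su2Character (i j : ZMod L) (m : Site 2 L → ℕ) {R : ℕ} (hR : 1 ≤ R)
    (hRL : R ≤ L) :
    ∀ (T : ℕ), 1 ≤ T → T ≤ L →
    ∀ (F : GaugeConfig 2 L (Matrix.specialUnitaryGroup (Fin 2) ℂ) → ℝ), Continuous F →
      (∀ a b : ℕ, 0 < a → a < R → b < T → ∀ V g, F (update V (![i + a, j + b], 1) g) = F V) →
      (∀ b : ℕ, 0 < b → b < T → ∀ V g, F (update V (![i, j + b], 0) g) = F V) →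
      ∫ V, F V * ∏ b ∈ range T, ∏ a ∈ range R,
          (U ℝ (m ![i + a, j + b])).eval (su2a0 (plaquetteHolonomy V ![i + a, j + b] 0 1))
          ∂(Measure.pi fun _ : Edge 2 L => haarProbability (Matrix.specialUnitaryGroup (Fin 2) ℂ)) =
        if (∀ a < R, ∀ b < T, m ![i + a, j + b] = m ![i, j]) then
          ((((m ![i, j] : ℝ) + 1) ^ (R * T - 1)))⁻¹ *
            ∫ V, F V * (U ℝ (m ![i, j])).eval (su2a0
              (((List.range R).map fun a : ℕ => V (![i + a, j], 0)).prod *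
                ((List.range T).map fun b : ℕ => V (![i + R, j + b], 1)).prod *
                (((List.range R).map fun a : ℕ => V (![i + a, j + T], 0)).prod)⁻¹ *
                (((List.range T).map fun b : ℕ => V (![i, j + b], 1)).prod)⁻¹))
              ∂(Measure.pi fun _ : Edge 2 L => haarProbability (Matrix.specialUnitaryGroup (Fin 2) ℂ))
        else 0 := by
  intro T
  induction T with
  | zero => intro h; omega
  | succ T' ih =>
    intro _ hTL F hFc hFv hFh
    rcases Nat.eq_zero_or_pos T' with rfl | hT'
    · -- one row: the strip lemma
      have hstrip := integral_mul_prod_strip_su2Character i j m R hR hRL F hFc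
        (fun a ha0 haR V g => by simpa using hFv a 0 ha0 haR (by omega) V g)
      simp only [zero_add, Finset.range_one, Finset.prod_singleton, Nat.cast_zero, add_zero]
      rw [hstrip]
      have hcond : (∀ a < R, m ![i + a, j] = m ![i, j]) ↔
          ∀ a < R, ∀ b < (0 : ℕ) + 1, m ![i + a, j + b] = m ![i, j] := by
        constructor
        · intro h a ha b hb
          obtain rfl : b = 0 := by omega
          rw [Nat.cast_zero, add_zero]
          exact h a ha
        · intro h a ha
          simpa using h a ha 0 (by omega)
      by_cases hC : ∀ a < R, m ![i + a, j] = m ![i, j]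
      · rw [if_pos hC, if_pos (hcond.mp hC), mul_one]
        simp only [List.range_one, List.map_singleton, List.prod_singleton, Nat.cast_zero, add_zero,
          Nat.cast_one]
      · rw [if_neg hC, if_neg (fun h => hC (hcond.mpr h))]
    · -- `T' + 1` rows, `T' ≥ 1`: merge the first `T'` rows (induction), the last row into a strip, then stack
      haveI : Fact (1 < L) := ⟨by omega⟩
      have h10 : (1 : ZMod L) ≠ 0 := one_ne_zero
      have hT'L : T' < L := by omega
      have hT'0 : (T' : ZMod L) ≠ 0 := fun h =>
        absurd (Nat.le_of_dvd hT' ((ZMod.natCast_eq_zero_iff T' L).1 h)) (by omega)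
      obtain ⟨R₀, rfl⟩ : ∃ R₀, R = R₀ + 1 := ⟨R - 1, by omega⟩
      -- names for the words
      set ρ : GaugeConfig 2 L (Matrix.specialUnitaryGroup (Fin 2) ℂ) → ℝ := fun V =>
        ∏ a ∈ range (R₀ + 1), (U ℝ (m ![i + a, j + T'])).eval
          (su2a0 (plaquetteHolonomy V ![i + a, j + T'] 0 1)) with hρ
      set Hbot : GaugeConfig 2 L (Matrix.specialUnitaryGroup (Fin 2) ℂ) → Matrix.specialUnitaryGroup (Fin 2) ℂ :=
        fun V => ((List.range (R₀ + 1)).map fun a : ℕ => V (![i + a, j], 0)).prod with hHbot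
      set Vr : GaugeConfig 2 L (Matrix.specialUnitaryGroup (Fin 2) ℂ) → Matrix.specialUnitaryGroup (Fin 2) ℂ :=
        fun V => ((List.range T').map fun b : ℕ => V (![i + (R₀ + 1 : ℕ), j + b], 1)).prod with hVr
      set Htop : GaugeConfig 2 L (Matrix.specialUnitaryGroup (Fin 2) ℂ) → Matrix.specialUnitaryGroup (Fin 2) ℂ :=
        fun V => ((List.range (R₀ + 1)).map fun a : ℕ => V (![i + a, j + T'], 0)).prod with hHtop
      set Htop' : GaugeConfig 2 L (Matrix.specialUnitaryGroup (Fin 2) ℂ) → Matrix.specialUnitaryGroup (Fin 2) ℂ :=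
        fun V => ((List.range R₀).map fun a : ℕ => V (![i + (a + 1 : ℕ), j + T'], 0)).prod with hHtop'
      set Hnext : GaugeConfig 2 L (Matrix.specialUnitaryGroup (Fin 2) ℂ) → Matrix.specialUnitaryGroup (Fin 2) ℂ :=
        fun V => ((List.range (R₀ + 1)).map fun a : ℕ => V (![i + a, j + T' + 1], 0)).prod with hHnext
      set Vl : GaugeConfig 2 L (Matrix.specialUnitaryGroup (Fin 2) ℂ) → Matrix.specialUnitaryGroup (Fin 2) ℂ :=
        fun V => ((List.range T').map fun b : ℕ => V (![i, j + b], 1)).prod with hVl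
      set c : Edge 2 L := (![i, j + T'], 0) with hc
      set s : Edge 2 L := (![i + (R₀ + 1 : ℕ), j + T'], 1) with hs
      set t : Edge 2 L := (![i, j + T'], 1) with ht
      have hHtop_split : ∀ V : GaugeConfig 2 L (Matrix.specialUnitaryGroup (Fin 2) ℂ), Htop V = V c * Htop' V := by
        intro V
        simp only [hHtop, hHtop', hc]
        rw [list_prod_range_succ_eq_head_mul]
        simp only [Nat.cast_zero, add_zero]
      -- continuity of the row product and of the loop character
      have hρc : Continuous ρ := by
        refine continuous_finsetProd _ fun a _ => continuous_su2Character_comp _ ?_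
        unfold plaquetteHolonomy
        fun_prop
      have hHbotc : Continuous Hbot := continuous_list_prod _ fun k _ => continuous_apply _
      have hVrc : Continuous Vr := continuous_list_prod _ fun k _ => continuous_apply _
      have hHtopc : Continuous Htop := continuous_list_prod _ fun k _ => continuous_apply _
      have hHtop'c : Continuous Htop' := continuous_list_prod _ fun k _ => continuous_apply _
      have hHnextc : Continuous Hnext := continuous_list_prod _ fun k _ => continuous_apply _
      have hVlc : Continuous Vl := continuous_list_prod _ fun k _ => continuous_apply _
      -- Step 1: split off the last row and merge the first `T'` rows (induction hypothesis)
      have hsplit : ∀ V : GaugeConfig 2 L (Matrix.specialUnitaryGroup (Fin 2) ℂ),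
          F V * ∏ b ∈ range (T' + 1), ∏ a ∈ range (R₀ + 1),
            (U ℝ (m ![i + a, j + b])).eval (su2a0 (plaquetteHolonomy V ![i + a, j + b] 0 1)) =
          (F V * ρ V) * ∏ b ∈ range T', ∏ a ∈ range (R₀ + 1),
            (U ℝ (m ![i + a, j + b])).eval (su2a0 (plaquetteHolonomy V ![i + a, j + b] 0 1)) := by
        intro V
        rw [Finset.prod_range_succ]
        ring
      simp_rw [hsplit]
      have hρv : ∀ a b : ℕ, 0 < a → a < R₀ + 1 → b < T' → ∀ V g, ρ (update V (![i + a, j + b], 1) g) = ρ V := by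
        intro a b ha0 haR hb V g
        simp only [hρ]
        refine Finset.prod_congr rfl fun a' _ => ?_
        have hne : (T' : ZMod L) ≠ (b : ZMod L) := (natCast_zmod_ne_of_lt (by omega) hT'L (by omega)).symm
        rw [TwoDim.plaquetteHolonomy_update_vert]
        · exact fun h => hne (add_left_cancel (vec2_eq_iff.mp h).2)
        · rw [shift_vec2_zero]
          exact fun h => hne (add_left_cancel (vec2_eq_iff.mp h).2)
      have hρh : ∀ b : ℕ, 0 < b → b < T' → ∀ V g, ρ (update V (![i, j + b], 0) g) = ρ V := by
        intro b hb0 hb V g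
        simp only [hρ]
        refine Finset.prod_congr rfl fun a' _ => ?_
        rw [TwoDim.plaquetteHolonomy_update_horiz]
        · exact fun h => (natCast_zmod_ne_of_lt (by omega) hT'L (by omega)).symm
            (add_left_cancel (vec2_eq_iff.mp h).2)
        · rw [shift_vec2_one, Ne, vec2_eq_iff, add_assoc, ← Nat.cast_succ]
          exact fun h => (natCast_zmod_ne_of_pos_lt_le hb0 (by omega) hTL) (add_left_cancel h.2).symm
      rw [ih hT' (by omega) (fun V => F V * ρ V) (hFc.mul hρc)
        (fun a b ha0 haR hb V g => by rw [hFv a b ha0 haR (by omega), hρv a b ha0 haR hb])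
        (fun b hb0 hb V g => by rw [hFh b hb0 (by omega), hρh b hb0 hb])]
      by_cases hC1 : ∀ a < R₀ + 1, ∀ b < T', m ![i + a, j + b] = m ![i, j]
      swap
      · have hC' : ¬ ∀ a < R₀ + 1, ∀ b < T' + 1, m ![i + a, j + b] = m ![i, j] :=
          fun h => hC1 fun a ha b hb => h a ha b (by omega)
        rw [if_neg hC1, if_neg hC']
      rw [if_pos hC1]
      -- Step 2: the last row becomes a strip, with `F · χ(W_{T'})` as spectator
      set Wold : GaugeConfig 2 L (Matrix.specialUnitaryGroup (Fin 2) ℂ) → Matrix.specialUnitaryGroup (Fin 2) ℂ :=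
        fun V => Hbot V * Vr V * (Htop V)⁻¹ * (Vl V)⁻¹ with hWold
      have hWoldc : Continuous Wold := by simp only [hWold]; fun_prop
      have hWold_v : ∀ a : ℕ, 0 < a → a < R₀ + 1 → ∀ V g, Wold (update V (![i + a, j + T'], 1) g) = Wold V := by
        intro a ha0 haR V g
        simp only [hWold, hHbot, hVr, hHtop, hVl]
        have hlink : ∀ (k : ℕ) (d : Fin 2) (x : ZMod L), k ∈ List.range T' →
            ((![x, j + k], d) : Edge 2 L) ≠ (![i + a, j + T'], 1) := by
          intro k d x hk h
          rw [List.mem_range] at hk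
          rw [Prod.mk.injEq, vec2_eq_iff] at h
          exact natCast_zmod_ne_of_lt (by omega) hT'L (by omega) (add_left_cancel h.1.2)
        rw [list_prod_map_update_of_ne V _ g _ (fun a' : ℕ => ((![i + a', j], 0) : Edge 2 L))
            fun k _ h => Fin.zero_ne_one (congrArg Prod.snd h),
          list_prod_map_update_of_ne V _ g _ (fun b : ℕ => ((![i + (R₀ + 1 : ℕ), j + b], 1) : Edge 2 L))
            fun k hk h => hlink k 1 _ hk h,
          list_prod_map_update_of_ne V _ g _ (fun a' : ℕ => ((![i + a', j + T'], 0) : Edge 2 L))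
            fun k _ h => Fin.zero_ne_one (congrArg Prod.snd h),
          list_prod_map_update_of_ne V _ g _ (fun b : ℕ => ((![i, j + b], 1) : Edge 2 L))
            fun k hk h => hlink k 1 _ hk h]
      have hreorder : ∀ V : GaugeConfig 2 L (Matrix.specialUnitaryGroup (Fin 2) ℂ),
          F V * ρ V * (U ℝ (m ![i, j])).eval (su2a0
            (((List.range (R₀ + 1)).map fun a : ℕ => V (![i + a, j], 0)).prod *
              ((List.range T').map fun b : ℕ => V (![i + (R₀ + 1 : ℕ), j + b], 1)).prod *
              (((List.range (R₀ + 1)).map fun a : ℕ => V (![i + a, j + T'], 0)).prod)⁻¹ *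
              (((List.range T').map fun b : ℕ => V (![i, j + b], 1)).prod)⁻¹)) =
          (F V * (U ℝ (m ![i, j])).eval (su2a0 (Wold V))) * ∏ a ∈ range (R₀ + 1),
            (U ℝ (m ![i + a, j + T'])).eval (su2a0 (plaquetteHolonomy V ![i + a, j + T'] 0 1)) := by
        intro V
        simp only [hρ, hWold, hHbot, hVr, hHtop, hVl]
        ring
      simp_rw [hreorder]
      rw [integral_mul_prod_strip_su2Character i (j + T') m (R₀ + 1) hR hRL
        (fun V => F V * (U ℝ (m ![i, j])).eval (su2a0 (Wold V)))
        (hFc.mul (continuous_su2Character_comp _ hWoldc))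
        (fun a ha0 haR V g => by
          show F _ * _ = F V * _
          rw [hFv a T' ha0 haR (by omega), hWold_v a ha0 haR])]
      by_cases hC2 : ∀ a < R₀ + 1, m ![i + a, j + T'] = m ![i, j + T']
      swap
      · have hC' : ¬ ∀ a < R₀ + 1, ∀ b < T' + 1, m ![i + a, j + b] = m ![i, j] := by
          intro h
          apply hC2
          intro a ha
          rw [h a ha T' (by omega)]
          have := h 0 (by omega) T' (by omega)
          rw [Nat.cast_zero, add_zero] at this
          exact this.symm
        rw [if_neg hC2, if_neg hC', mul_zero]
      rw [if_pos hC2]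
      -- Step 3: stack the strip onto `W_{T'}` along the first rung link `c = h(i, j+T')`
      set β : GaugeConfig 2 L (Matrix.specialUnitaryGroup (Fin 2) ℂ) → Matrix.specialUnitaryGroup (Fin 2) ℂ :=
        fun V => Htop' V * V s * (Hnext V)⁻¹ * (V t)⁻¹ with hβ
      set γ : GaugeConfig 2 L (Matrix.specialUnitaryGroup (Fin 2) ℂ) → Matrix.specialUnitaryGroup (Fin 2) ℂ :=
        fun V => (Vl V)⁻¹ * Hbot V * Vr V * (Htop' V)⁻¹ with hγ
      have hHtop'u : ∀ V g, Htop' (update V c g) = Htop' V := by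
        intro V g
        refine list_prod_map_update_of_ne V c g _ _ fun k hk h => ?_
        rw [List.mem_range] at hk
        rw [hc, Prod.mk.injEq, vec2_eq_iff] at h
        exact absurd (Nat.le_of_dvd (Nat.succ_pos k) ((ZMod.natCast_eq_zero_iff (k + 1) L).1
          (add_eq_left.mp h.1.1))) (by omega)
      have hβu : ∀ V g, β (update V c g) = β V := by
        intro V g
        simp only [hβ, hHnext]
        rw [hHtop'u, update_of_ne (fun h => Fin.zero_ne_one (congrArg Prod.snd h).symm),
          update_of_ne (fun h => Fin.zero_ne_one (congrArg Prod.snd h).symm),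
          list_prod_map_update_of_ne V c g _ (fun a : ℕ => ((![i + a, j + T' + 1], 0) : Edge 2 L))
            fun k _ h => ?_]
        rw [hc, Prod.mk.injEq, vec2_eq_iff] at h
        exact h10 (add_eq_left.mp h.1.2)
      have hγu : ∀ V g, γ (update V c g) = γ V := by
        intro V g
        simp only [hγ, hVl, hHbot, hVr]
        rw [hHtop'u, list_prod_map_update_of_ne V c g _ (fun b : ℕ => ((![i, j + b], 1) : Edge 2 L))
            fun k _ h => Fin.zero_ne_one (congrArg Prod.snd h).symm,
          list_prod_map_update_of_ne V c g _ (fun b : ℕ => ((![i + (R₀ + 1 : ℕ), j + b], 1) : Edge 2 L))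
            fun k _ h => Fin.zero_ne_one (congrArg Prod.snd h).symm,
          list_prod_map_update_of_ne V c g _ (fun a : ℕ => ((![i + a, j], 0) : Edge 2 L)) fun k _ h => ?_]
        rw [hc, Prod.mk.injEq, vec2_eq_iff] at h
        exact hT'0 (left_eq_add.mp h.1.2)
      have hβc : Continuous β := by simp only [hβ]; fun_prop
      have hγc : Continuous γ := by simp only [hγ]; fun_prop
      have hmerge := integral_pi_su2_merge (ι := Edge 2 L) c (fun _ => 1) β γ F (fun _ _ => rfl) hβu hγu
        (fun V g => hFh T' hT' (by omega) V g) continuous_const hβc hγc hFc (m ![i, j + T']) (m ![i, j])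
      have hpt : ∀ V : GaugeConfig 2 L (Matrix.specialUnitaryGroup (Fin 2) ℂ),
          F V * (U ℝ (m ![i, j])).eval (su2a0 (Wold V)) * (U ℝ (m ![i, j + T'])).eval (su2a0
            (((List.range (R₀ + 1)).map fun a : ℕ => V (![i + a, j + T'], 0)).prod * V (![i + (R₀ + 1 : ℕ), j + T'], 1) *
              (((List.range (R₀ + 1)).map fun a : ℕ => V (![i + a, j + T' + 1], 0)).prod)⁻¹ * (V (![i, j + T'], 1))⁻¹)) =
          (U ℝ (m ![i, j + T'])).eval (su2a0 ((fun _ => (1 : Matrix.specialUnitaryGroup (Fin 2) ℂ)) V * V c * β V)) *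
            (U ℝ (m ![i, j])).eval (su2a0 (γ V * (V c)⁻¹)) * F V := by
        intro V
        have h1 : ((List.range (R₀ + 1)).map fun a : ℕ => V (![i + a, j + T'], 0)).prod * V (![i + (R₀ + 1 : ℕ), j + T'], 1) *
            (((List.range (R₀ + 1)).map fun a : ℕ => V (![i + a, j + T' + 1], 0)).prod)⁻¹ * (V (![i, j + T'], 1))⁻¹ =
            (fun _ => (1 : Matrix.specialUnitaryGroup (Fin 2) ℂ)) V * V c * β V := by
          have := hHtop_split V
          simp only [hHtop] at this
          simp only [hβ, hs, ht, hHnext, this]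
          group
        have h2 : su2a0 (Wold V) = su2a0 (γ V * (V c)⁻¹) := by
          simp only [hWold, hγ]
          rw [hHtop_split V, show Hbot V * Vr V * (V c * Htop' V)⁻¹ * (Vl V)⁻¹ =
            (Hbot V * Vr V * (Htop' V)⁻¹ * (V c)⁻¹) * (Vl V)⁻¹ by group, su2a0_mul_comm]
          congr 1
          group
        rw [h1, h2]
        ring
      simp_rw [hpt]
      rw [hmerge]
      by_cases hmc : m ![i, j + T'] = m ![i, j]
      swap
      · have hC' : ¬ ∀ a < R₀ + 1, ∀ b < T' + 1, m ![i + a, j + b] = m ![i, j] := by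
          intro h
          have := h 0 (by omega) T' (by omega)
          rw [Nat.cast_zero, add_zero] at this
          exact hmc this
        rw [if_neg hmc, if_neg hC', mul_zero, mul_zero]
      have hC' : ∀ a < R₀ + 1, ∀ b < T' + 1, m ![i + a, j + b] = m ![i, j] := by
        intro a ha b hb
        by_cases hb' : b < T'
        · exact hC1 a ha b hb'
        · obtain rfl : b = T' := by omega
          rw [hC2 a ha, hmc]
      rw [if_pos hmc, if_pos hC', hmc]
      -- constants
      have hN : (R₀ + 1) * (T' + 1) - 1 = ((R₀ + 1) * T' - 1) + (R₀ + 1 - 1) + 1 := by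
        have hpos : 0 < (R₀ + 1) * T' := Nat.mul_pos (Nat.succ_pos _) hT'
        rw [Nat.mul_succ]
        omega
      rw [← mul_assoc, ← mul_assoc, ← mul_inv, ← mul_inv, ← pow_add, ← pow_succ, ← hN]
      -- the merged word is `W_{T'+1}`
      have hword : ∀ V : GaugeConfig 2 L (Matrix.specialUnitaryGroup (Fin 2) ℂ),
          su2a0 (1 * γ V * β V) = su2a0
            (((List.range (R₀ + 1)).map fun a : ℕ => V (![i + a, j], 0)).prod *
              ((List.range (T' + 1)).map fun b : ℕ => V (![i + (R₀ + 1 : ℕ), j + b], 1)).prod *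
              (((List.range (R₀ + 1)).map fun a : ℕ => V (![i + a, j + (T' + 1 : ℕ)], 0)).prod)⁻¹ *
              (((List.range (T' + 1)).map fun b : ℕ => V (![i, j + b], 1)).prod)⁻¹) := by
        intro V
        rw [show 1 * γ V * β V = (Vl V)⁻¹ * (Hbot V * (Vr V * V s) * (Hnext V)⁻¹ * (V t)⁻¹) by
          simp only [hγ, hβ]; group, su2a0_mul_comm]
        refine congrArg su2a0 ?_
        simp only [hHbot, hVr, hHnext, hVl, hs, ht, list_prod_range_succ, Nat.cast_succ, mul_inv_rev,
          ← add_assoc]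
        group
      congr 1
      refine integral_congr_ae (Filter.Eventually.of_forall fun V => ?_)
      beta_reduce
      rw [hword V]
      ring

end Summit.Ventures.LatticeQCDFlow.Scoring
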